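import Mathlib
import Summits.Ventures.HodgeRepro.Tier4.Target
import Summits.Ventures.HodgeRepro.Tier4.Common.TargetCalculus
import Summits.Ventures.HodgeRepro.Tier4.Common.AutForms

/-!
# Tier4/Line4/Osgood — the several-variable regularity core: partial derivatives of a holomorphic function of two
complex variables are holomorphic; such a function is `C^n` (over `ℂ`, hence over `ℝ`) for every `n`; mixed second
partials commute

Blind re-derivation cell `pub-hodge-repro`, Tier 4 «prove the step» (README §9–§10), seat t4-L4-p1 (prover, LINE L4,
gen 0; lead's assignment S12161 (1)).  Tree path `lean/Summits/Ventures/HodgeRepro/Tier4/Line4/Osgood.lean`.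
Mathlib-level; no literature input.  Consumed by L4.2 `mixed_closed` (t4-L4-p2) and L4.2′ `mixed_smooth`.

WHAT IS PROVED.  Mathlib proves «holomorphic ⟹ analytic» for functions of ONE complex variable only
(`Complex.analyticOnNhd_iff_differentiableOn`; no Osgood / Hartogs).  For `u : (Fin 2 → ℂ) → ℂ` ℂ-differentiable on an
open set `U` we prove here, with the frozen target's partial derivative `pd k u z = fderiv ℂ u z (Pi.single k 1)`:
* `differentiableOn_pd_of_isOpen`: `pd k u` is ℂ-differentiable on `U`;
* `contDiffOn_of_isOpen`: `ContDiffOn ℂ n u U` for every `n : ℕ`, hence `contDiffOn_real_of_isOpen`: `ContDiffOn ℝ n u U`;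
* `pd_pd_comm_of_isOpen`: `pd m (pd k u) z = pd k (pd m u) z` for `z ∈ U`;
and their specialisations to the ball `𝔹²` (`differentiableOn_pd_ball`, `contDiffOn_ball`, `contDiffOn_real_ball`,
`contDiffOn_real_pd_ball`, `pd_pd_comm`).

HOW.  `pd k u z` is the one-variable derivative of the coordinate slice `t ↦ u (Function.update z k t)` at `t = z k`
(`hasDerivAt_update` + chain rule); Cauchy's formula for the derivative on a circle of radius `r`
(`DifferentiableOn.deriv_eq_smul_circleIntegral`) writes it as `(2πi)⁻¹ ∫₀^{2π} κ(θ) · u (z + Pi.single k (r e^{iθ})) dθ`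
with the kernel `κ(θ) = i / (r e^{iθ})` INDEPENDENT of `z` — an integral of translates of `u`.  Differentiating once
under the integral sign (`intervalIntegral.hasFDerivAt_integral_of_dominated_of_fderiv_le`) only needs a uniform bound on
`‖fderiv ℂ u‖` near `z`, which the one-variable Cauchy estimate (`Complex.norm_deriv_le_of_forall_mem_sphere_norm_le`)
on each coordinate slice provides from the boundedness of the continuous `u` on a compact polydisc
(`‖fderiv ℂ u y‖ ≤ Σ_j |pd j u y| ≤ 2 M / r`).  So `pd k u` is ℂ-differentiable; iterating with
`contDiffOn_succ_iff_fderiv_of_isOpen` (`fderiv ℂ u = Σ_k pd k u • proj k`) gives `C^n` for every `n`, and the symmetry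
of the second derivative of a `C²` function (`ContDiffAt.isSymmSndFDerivAt`) gives `pd m (pd k u) = pd k (pd m u)`.

HC_CM is NOT proved by anyone in this repository.
-/

set_option autoImplicit false

noncomputable section

open Complex MeasureTheory Metric Set Filter
open scoped Real Topology Interval

namespace Summit.Ventures.HodgeRepro.Tier4.Line4

open Summit.Ventures.HodgeRepro.Tier4

/-! ## 1. The partial derivative as the derivative of a coordinate slice -/

/-- `update z k (z k + w) = z + Pi.single k w`. -/
theorem update_add_eq (z : Fin 2 → ℂ) (k : Fin 2) (w : ℂ) :
    Function.update z k (z k + w) = z + Pi.single k w := by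
  ext j
  by_cases hj : j = k
  · subst hj; simp
  · simp [hj]

/-- The partial derivative is the derivative of the coordinate slice `t ↦ u (update z k t)` at `z k`. -/
theorem pd_eq_deriv_update {u : (Fin 2 → ℂ) → ℂ} {z : Fin 2 → ℂ} (hu : DifferentiableAt ℂ u z) (k : Fin 2) :
    pd k u z = deriv (fun t => u (Function.update z k t)) (z k) := by
  have h1 : HasDerivAt (Function.update z k) (Pi.single k (1 : ℂ)) (z k) := hasDerivAt_update z k (z k)
  have hl : HasFDerivAt u (fderiv ℂ u z) (Function.update z k (z k)) := by
    rw [Function.update_eq_self]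
    exact hu.hasFDerivAt
  have h2 := hl.comp_hasDerivAt (z k) h1
  show pd k u z = deriv (u ∘ Function.update z k) (z k)
  rw [h2.deriv]
  rfl

/-- The coordinate slice of a function differentiable on an open set is differentiable on a disc whose points stay in
the set. -/
theorem differentiableOn_slice {u : (Fin 2 → ℂ) → ℂ} {U : Set (Fin 2 → ℂ)} (hU : IsOpen U)
    (hu : DifferentiableOn ℂ u U) (z : Fin 2 → ℂ) (k : Fin 2) {r : ℝ}
    (hr : ∀ t ∈ closedBall (z k) r, Function.update z k t ∈ U) :
    DifferentiableOn ℂ (fun t => u (Function.update z k t)) (closedBall (z k) r) := by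
  intro t ht
  have hd : DifferentiableAt ℂ u (Function.update z k t) := hu.differentiableAt (hU.mem_nhds (hr t ht))
  exact (hd.comp t (hasDerivAt_update z k t).differentiableAt).differentiableWithinAt

/-! ## 2. Cauchy's formula for the partial derivative: an integral of translates -/

/-- The kernel `κ r θ = (r e^{iθ} · i) · (1 / (r e^{iθ})²)` of Cauchy's formula for the first derivative, after the
parametrisation of the circle. -/
def cauchyKernel (r : ℝ) (θ : ℝ) : ℂ := circleMap 0 r θ * I * (1 / (circleMap 0 r θ) ^ 2)

/-- `‖κ r θ‖ = 1 / r` for `r > 0`. -/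
theorem norm_cauchyKernel {r : ℝ} (hr : 0 < r) (θ : ℝ) : ‖cauchyKernel r θ‖ = 1 / r := by
  simp only [cauchyKernel, norm_mul, norm_I, mul_one, norm_div, norm_one, norm_pow, norm_circleMap_zero,
    abs_of_pos hr]
  field_simp

/-- The kernel is continuous in `θ` for `r ≠ 0`. -/
theorem continuous_cauchyKernel {r : ℝ} (hr : r ≠ 0) : Continuous (cauchyKernel r) := by
  unfold cauchyKernel
  refine ((continuous_circleMap 0 r).mul continuous_const).mul ?_
  refine continuous_const.div (by fun_prop) fun θ => ?_
  exact pow_ne_zero _ (circleMap_ne_center hr)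

/-- **Cauchy's formula for the partial derivative**: for `r > 0` and the slice disc `update z k (closedBall (z k) r)`
inside `U`, `pd k u z = (2πi)⁻¹ ∫₀^{2π} κ r θ · u (z + Pi.single k (r e^{iθ})) dθ`. -/
theorem pd_eq_integral {u : (Fin 2 → ℂ) → ℂ} {U : Set (Fin 2 → ℂ)} (hU : IsOpen U) (hu : DifferentiableOn ℂ u U)
    (z : Fin 2 → ℂ) (k : Fin 2) {r : ℝ} (hr : 0 < r)
    (hball : ∀ t ∈ closedBall (z k) r, Function.update z k t ∈ U) :
    pd k u z = (2 * π * I)⁻¹ • ∫ θ in (0 : ℝ)..2 * π,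
      cauchyKernel r θ • u (z + Pi.single k (circleMap 0 r θ)) := by
  have hz : z ∈ U := by
    have := hball (z k) (mem_closedBall_self hr.le)
    rwa [Function.update_eq_self] at this
  have hslice := differentiableOn_slice hU hu z k hball
  have hC := hslice.deriv_eq_smul_circleIntegral hr
  rw [pd_eq_deriv_update (hu.differentiableAt (hU.mem_nhds hz)) k]
  have h2 : (2 * π * I) ≠ 0 := by simp [Real.pi_ne_zero, I_ne_zero]
  have hd : deriv (fun t => u (Function.update z k t)) (z k) =
      (2 * π * I)⁻¹ • ∮ t in C(z k, r), (1 / (t - z k) ^ 2) • u (Function.update z k t) := by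
    rw [hC, smul_smul, inv_mul_cancel₀ h2, one_smul]
  rw [hd]
  congr 1
  simp only [circleIntegral, deriv_circleMap, circleMap_sub_center]
  refine intervalIntegral.integral_congr fun θ _ => ?_
  simp only [cauchyKernel, smul_eq_mul, mul_assoc]
  rw [show circleMap (z k) r θ = z k + circleMap 0 r θ by simp [circleMap], update_add_eq]

/-! ## 3. The Cauchy estimate: `‖fderiv ℂ u‖` is bounded on a polydisc -/

/-- `‖Pi.single k w‖ = ‖w‖`. -/
theorem norm_pi_single (k : Fin 2) (w : ℂ) : ‖(Pi.single k w : Fin 2 → ℂ)‖ = ‖w‖ := by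
  simpa using Pi.norm_single (G := fun _ : Fin 2 => ℂ) (i := k) w

/-- Points of the slice disc of radius `r` through `y ∈ closedBall z₀ R` lie in `closedBall z₀ (R + r)`. -/
theorem update_mem_closedBall {z₀ y : Fin 2 → ℂ} {R : ℝ} (hy : y ∈ closedBall z₀ R) (k : Fin 2) {r : ℝ}
    (hr : 0 ≤ r) {t : ℂ} (ht : t ∈ closedBall (y k) r) : Function.update y k t ∈ closedBall z₀ (R + r) := by
  rw [mem_closedBall, dist_eq_norm] at hy ht ⊢
  have hR : 0 ≤ R := (norm_nonneg _).trans hy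
  rw [pi_norm_le_iff_of_nonneg (by linarith)]
  intro j
  by_cases hj : j = k
  · subst hj
    simp only [Pi.sub_apply, Function.update_self]
    calc ‖t - z₀ j‖ = ‖(t - y j) + (y j - z₀ j)‖ := by congr 1; abel
      _ ≤ ‖t - y j‖ + ‖y j - z₀ j‖ := norm_add_le _ _
      _ ≤ r + R := add_le_add ht ((norm_le_pi_norm (y - z₀) j).trans hy)
      _ = R + r := add_comm _ _
  · simp only [Pi.sub_apply, Function.update_of_ne hj]
    calc ‖y j - z₀ j‖ ≤ ‖y - z₀‖ := norm_le_pi_norm (y - z₀) j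
      _ ≤ R := hy
      _ ≤ R + r := by linarith

/-- The Cauchy estimate for one partial derivative: if `‖u‖ ≤ M` on `closedBall z₀ (R + r)` and `y ∈ closedBall z₀ R`,
then `‖pd j u y‖ ≤ M / r`. -/
theorem norm_pd_le {u : (Fin 2 → ℂ) → ℂ} {U : Set (Fin 2 → ℂ)} (hU : IsOpen U) (hu : DifferentiableOn ℂ u U)
    {z₀ : Fin 2 → ℂ} {R r M : ℝ} (hr : 0 < r) (hsub : closedBall z₀ (R + r) ⊆ U)
    (hM : ∀ x ∈ closedBall z₀ (R + r), ‖u x‖ ≤ M) {y : Fin 2 → ℂ} (hy : y ∈ closedBall z₀ R) (j : Fin 2) :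
    ‖pd j u y‖ ≤ M / r := by
  have hball : ∀ t ∈ closedBall (y j) r, Function.update y j t ∈ U :=
    fun t ht => hsub (update_mem_closedBall hy j hr.le ht)
  have hy' : y ∈ U := by
    have := hball (y j) (mem_closedBall_self hr.le)
    rwa [Function.update_eq_self] at this
  rw [pd_eq_deriv_update (hu.differentiableAt (hU.mem_nhds hy')) j]
  have hslice := differentiableOn_slice hU hu y j hball
  refine Complex.norm_deriv_le_of_forall_mem_sphere_norm_le hr
    ((hslice.mono closure_ball_subset_closedBall).diffContOnCl) fun t ht => ?_
  exact hM _ (update_mem_closedBall hy j hr.le (sphere_subset_closedBall ht))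

/-- The bound on the full derivative: `‖fderiv ℂ u y‖ ≤ 2 M / r` on `closedBall z₀ R` when `‖u‖ ≤ M` on
`closedBall z₀ (R + r) ⊆ U`. -/
theorem norm_fderiv_le {u : (Fin 2 → ℂ) → ℂ} {U : Set (Fin 2 → ℂ)} (hU : IsOpen U) (hu : DifferentiableOn ℂ u U)
    {z₀ : Fin 2 → ℂ} {R r M : ℝ} (hr : 0 < r) (hsub : closedBall z₀ (R + r) ⊆ U)
    (hM : ∀ x ∈ closedBall z₀ (R + r), ‖u x‖ ≤ M) {y : Fin 2 → ℂ} (hy : y ∈ closedBall z₀ R) :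
    ‖fderiv ℂ u y‖ ≤ 2 * (M / r) := by
  have hM0 : 0 ≤ M := by
    have h0 := hM z₀ (mem_closedBall_self (by linarith [hr, (dist_nonneg.trans hy : (0 : ℝ) ≤ R)]))
    exact (norm_nonneg _).trans h0
  refine ContinuousLinearMap.opNorm_le_bound _ (by positivity) fun w => ?_
  rw [fderiv_apply_eq_sum_pd, Fin.sum_univ_two]
  have h0 := norm_pd_le hU hu hr hsub hM hy 0
  have h1 := norm_pd_le hU hu hr hsub hM hy 1
  have hw0 : ‖w 0‖ ≤ ‖w‖ := norm_le_pi_norm w 0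
  have hw1 : ‖w 1‖ ≤ ‖w‖ := norm_le_pi_norm w 1
  calc ‖w 0 * pd 0 u y + w 1 * pd 1 u y‖ ≤ ‖w 0 * pd 0 u y‖ + ‖w 1 * pd 1 u y‖ := norm_add_le _ _
    _ = ‖w 0‖ * ‖pd 0 u y‖ + ‖w 1‖ * ‖pd 1 u y‖ := by rw [norm_mul, norm_mul]
    _ ≤ ‖w‖ * (M / r) + ‖w‖ * (M / r) := by
        gcongr
    _ = 2 * (M / r) * ‖w‖ := by ring

/-! ## 4. Differentiating Cauchy's formula under the integral sign -/

/-- The translate map `θ ↦ z + Pi.single k (r e^{iθ})` is continuous. -/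
theorem continuous_translate (z : Fin 2 → ℂ) (k : Fin 2) (r : ℝ) :
    Continuous fun θ : ℝ => z + Pi.single k (circleMap 0 r θ) := by
  refine continuous_const.add (continuous_pi fun j => ?_)
  rcases eq_or_ne j k with rfl | hj
  · simpa using continuous_circleMap 0 r
  · simp only [Pi.single_eq_of_ne hj]
    exact continuous_const

/-- **The partial derivative of a holomorphic function of two variables is holomorphic** (at a point of an open set). -/
theorem differentiableAt_pd_of_isOpen {u : (Fin 2 → ℂ) → ℂ} {U : Set (Fin 2 → ℂ)} (hU : IsOpen U)
    (hu : DifferentiableOn ℂ u U) {z₀ : Fin 2 → ℂ} (hz₀ : z₀ ∈ U) (k : Fin 2) :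
    DifferentiableAt ℂ (pd k u) z₀ := by
  -- a polydisc `closedBall z₀ (3r) ⊆ U`
  obtain ⟨r, hr, h3r⟩ : ∃ r : ℝ, 0 < r ∧ closedBall z₀ (3 * r) ⊆ U := by
    obtain ⟨ε, hε, hεU⟩ := Metric.isOpen_iff.1 hU z₀ hz₀
    refine ⟨ε / 4, by positivity, fun x hx => hεU ?_⟩
    rw [mem_closedBall] at hx
    rw [Metric.mem_ball]
    linarith
  have h2r : closedBall z₀ (2 * r) ⊆ closedBall z₀ (3 * r) := closedBall_subset_closedBall (by linarith)
  -- `u` is bounded on the compact polydisc `closedBall z₀ (3r)`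
  obtain ⟨M, hM⟩ := (isCompact_closedBall z₀ (3 * r)).exists_bound_of_continuousOn (hu.continuousOn.mono h3r)
  have hsub' : closedBall z₀ (2 * r + r) ⊆ U := by
    rw [show (2 : ℝ) * r + r = 3 * r by ring]; exact h3r
  have hM' : ∀ x ∈ closedBall z₀ (2 * r + r), ‖u x‖ ≤ M := by
    rw [show (2 : ℝ) * r + r = 3 * r by ring]; exact hM
  -- the bound on `‖fderiv ℂ u‖` on `closedBall z₀ (2r)`
  have hbound : ∀ y ∈ closedBall z₀ (2 * r), ‖fderiv ℂ u y‖ ≤ 2 * (M / r) :=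
    fun y hy => norm_fderiv_le hU hu hr hsub' hM' hy
  -- the translates stay in `closedBall z₀ (2r)` for `z ∈ ball z₀ r`
  have htrans : ∀ z ∈ Metric.ball z₀ r, ∀ θ : ℝ, z + Pi.single k (circleMap 0 r θ) ∈ closedBall z₀ (2 * r) := by
    intro z hz θ
    have hz' : z ∈ closedBall z₀ r := Metric.ball_subset_closedBall hz
    have ht : z k + circleMap 0 r θ ∈ closedBall (z k) r := by
      rw [mem_closedBall, dist_eq_norm, add_sub_cancel_left, norm_circleMap_zero, abs_of_pos hr]
    have := update_mem_closedBall hz' k hr.le ht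
    rw [update_add_eq, show r + r = 2 * r by ring] at this
    exact this
  -- Cauchy's formula holds for every `z ∈ ball z₀ r`
  have hformula : ∀ z ∈ Metric.ball z₀ r, pd k u z = (2 * π * I)⁻¹ • ∫ θ in (0 : ℝ)..2 * π,
      cauchyKernel r θ • u (z + Pi.single k (circleMap 0 r θ)) := by
    intro z hz
    refine pd_eq_integral hU hu z k hr fun t ht => ?_
    have hz' : z ∈ closedBall z₀ r := Metric.ball_subset_closedBall hz
    have := update_mem_closedBall hz' k hr.le ht
    rw [show r + r = 2 * r by ring] at this
    exact h3r (h2r this)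
  -- the parametric integral
  set F : (Fin 2 → ℂ) → ℝ → ℂ := fun z θ => cauchyKernel r θ • u (z + Pi.single k (circleMap 0 r θ)) with hF
  set F' : (Fin 2 → ℂ) → ℝ → ((Fin 2 → ℂ) →L[ℂ] ℂ) :=
    fun z θ => cauchyKernel r θ • fderiv ℂ u (z + Pi.single k (circleMap 0 r θ)) with hF'
  have hcont : ∀ z ∈ Metric.ball z₀ r, Continuous (F z) := by
    intro z hz
    refine (continuous_cauchyKernel hr.ne').smul ?_
    refine (hu.continuousOn.mono h3r).comp_continuous (continuous_translate z k r) fun θ => h2r (htrans z hz θ)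
  have hmeasF' : AEStronglyMeasurable (F' z₀) (volume.restrict (Ι (0 : ℝ) (2 * π))) := by
    refine ((continuous_cauchyKernel hr.ne').aestronglyMeasurable).smul ?_
    refine Measurable.aestronglyMeasurable ?_
    exact (measurable_fderiv ℂ u).comp (continuous_translate z₀ k r).measurable
  have hderiv : HasFDerivAt (fun z => ∫ θ in (0 : ℝ)..2 * π, F z θ) (∫ θ in (0 : ℝ)..2 * π, F' z₀ θ) z₀ := by
    refine intervalIntegral.hasFDerivAt_integral_of_dominated_of_fderiv_le (s := Metric.ball z₀ r)
      (bound := fun _ => (1 / r) * (2 * (M / r))) (Metric.ball_mem_nhds z₀ hr) ?_ ?_ hmeasF' ?_ ?_ ?_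
    · filter_upwards [Metric.ball_mem_nhds z₀ hr] with z hz
      exact (hcont z hz).aestronglyMeasurable
    · exact (hcont z₀ (Metric.mem_ball_self hr)).intervalIntegrable _ _
    · refine Filter.Eventually.of_forall fun θ _ z hz => ?_
      simp only [hF', norm_smul, norm_cauchyKernel hr]
      gcongr
      exact hbound _ (htrans z hz θ)
    · exact intervalIntegrable_const
    · refine Filter.Eventually.of_forall fun θ _ z hz => ?_
      simp only [hF, hF']
      have hd : DifferentiableAt ℂ u (z + Pi.single k (circleMap 0 r θ)) :=
        hu.differentiableAt (hU.mem_nhds (h3r (h2r (htrans z hz θ))))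
      have hd' : HasFDerivAt (fun z => u (z + Pi.single k (circleMap 0 r θ)))
          (fderiv ℂ u (z + Pi.single k (circleMap 0 r θ))) z :=
        (hasFDerivAt_comp_add_right _).2 hd.hasFDerivAt
      exact hd'.const_smul (cauchyKernel r θ)
  have hfinal : HasFDerivAt (pd k u) ((2 * π * I)⁻¹ • ∫ θ in (0 : ℝ)..2 * π, F' z₀ θ) z₀ := by
    refine (hderiv.const_smul ((2 * π * I)⁻¹)).congr_of_eventuallyEq ?_
    filter_upwards [Metric.ball_mem_nhds z₀ hr] with z hz
    exact hformula z hz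
  exact hfinal.differentiableAt

/-- **The partial derivatives of a holomorphic function of two variables are holomorphic** on an open set. -/
theorem differentiableOn_pd_of_isOpen {u : (Fin 2 → ℂ) → ℂ} {U : Set (Fin 2 → ℂ)} (hU : IsOpen U)
    (hu : DifferentiableOn ℂ u U) (k : Fin 2) : DifferentiableOn ℂ (pd k u) U :=
  fun _ hz => (differentiableAt_pd_of_isOpen hU hu hz k).differentiableWithinAt

/-! ## 5. `C^n` for every `n`, over `ℂ` and over `ℝ` -/

/-- `fderiv ℂ u = Σ_k pd k u • proj k` (as functions). -/
theorem fderiv_eq_sum_pd_smul_proj (u : (Fin 2 → ℂ) → ℂ) :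
    fderiv ℂ u = fun y => ∑ k : Fin 2, pd k u y • (ContinuousLinearMap.proj k : (Fin 2 → ℂ) →L[ℂ] ℂ) := by
  funext y
  ext w
  rw [fderiv_apply_eq_sum_pd]
  simp only [sum_apply, smul_apply, ContinuousLinearMap.proj_apply, smul_eq_mul]
  refine Finset.sum_congr rfl fun k _ => mul_comm _ _

/-- **A holomorphic function of two variables is `C^n` over `ℂ` for every `n`** on an open set. -/
theorem contDiffOn_of_isOpen {U : Set (Fin 2 → ℂ)} (hU : IsOpen U) (n : ℕ) :
    ∀ {u : (Fin 2 → ℂ) → ℂ}, DifferentiableOn ℂ u U → ContDiffOn ℂ n u U := by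
  induction n with
  | zero => intro u hu; exact contDiffOn_zero.2 hu.continuousOn
  | succ n ih =>
    intro u hu
    rw [show ((n + 1 : ℕ) : WithTop ℕ∞) = (n : WithTop ℕ∞) + 1 by norm_cast,
      contDiffOn_succ_iff_fderiv_of_isOpen hU]
    refine ⟨hu, fun h => by simp at h, ?_⟩
    rw [fderiv_eq_sum_pd_smul_proj]
    exact ContDiffOn.sum fun k _ => (ih (differentiableOn_pd_of_isOpen hU hu k)).smul contDiffOn_const

/-- `C^n` over `ℝ` for every `n`. -/
theorem contDiffOn_real_of_isOpen {u : (Fin 2 → ℂ) → ℂ} {U : Set (Fin 2 → ℂ)} (hU : IsOpen U)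
    (hu : DifferentiableOn ℂ u U) (n : ℕ) : ContDiffOn ℝ n u U :=
  (contDiffOn_of_isOpen hU n hu).restrict_scalars ℝ

/-! ## 6. Symmetry of the mixed second partials -/

/-- `pd m (pd k u) z = fderiv ℂ (fderiv ℂ u) z (e_m) (e_k)` where `fderiv ℂ u` is differentiable at `z`. -/
theorem pd_pd_eq_fderiv_fderiv {u : (Fin 2 → ℂ) → ℂ} {z : Fin 2 → ℂ} (hd : DifferentiableAt ℂ (fderiv ℂ u) z)
    (m k : Fin 2) :
    pd m (pd k u) z = fderiv ℂ (fderiv ℂ u) z (Pi.single m 1) (Pi.single k 1) := by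
  have h := hd.hasFDerivAt.clm_apply (hasFDerivAt_const (Pi.single k (1 : ℂ) : Fin 2 → ℂ) z)
  show fderiv ℂ (fun y => fderiv ℂ u y (Pi.single k 1)) z (Pi.single m 1) = _
  rw [h.fderiv]
  simp

/-- **Mixed second partials commute** for a holomorphic function of two variables on an open set. -/
theorem pd_pd_comm_of_isOpen {u : (Fin 2 → ℂ) → ℂ} {U : Set (Fin 2 → ℂ)} (hU : IsOpen U)
    (hu : DifferentiableOn ℂ u U) (m k : Fin 2) {z : Fin 2 → ℂ} (hz : z ∈ U) :
    pd m (pd k u) z = pd k (pd m u) z := by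
  have h2 : ContDiffAt ℂ 2 u z := (contDiffOn_of_isOpen hU 2 hu).contDiffAt (hU.mem_nhds hz)
  have hd : DifferentiableAt ℂ (fderiv ℂ u) z := by
    have h3 : ContDiffOn ℂ (1 + 1) u U := by
      have := contDiffOn_of_isOpen hU 2 hu
      exact this
    rw [contDiffOn_succ_iff_fderiv_of_isOpen hU] at h3
    exact (h3.2.2.differentiableOn one_ne_zero).differentiableAt (hU.mem_nhds hz)
  have hsymm : IsSymmSndFDerivAt ℂ u z := h2.isSymmSndFDerivAt (by simp)
  rw [pd_pd_eq_fderiv_fderiv hd, pd_pd_eq_fderiv_fderiv hd]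
  exact hsymm _ _

/-! ## 7. Specialisations to the ball `𝔹²` (the domain of the Albanese lifts of the frozen target) -/

/-- The partial derivatives of a holomorphic function on the ball are holomorphic on the ball. -/
theorem differentiableOn_pd_ball {u : (Fin 2 → ℂ) → ℂ} (hu : DifferentiableOn ℂ u ball) (k : Fin 2) :
    DifferentiableOn ℂ (pd k u) ball :=
  differentiableOn_pd_of_isOpen isOpen_ball hu k

/-- The partial derivative is differentiable at every point of the ball. -/
theorem differentiableAt_pd_of_mem_ball {u : (Fin 2 → ℂ) → ℂ} (hu : DifferentiableOn ℂ u ball) (k : Fin 2)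
    {z : Fin 2 → ℂ} (hz : z ∈ ball) : DifferentiableAt ℂ (pd k u) z :=
  differentiableAt_pd_of_isOpen isOpen_ball hu hz k

/-- A holomorphic function on the ball is `C^n` over `ℂ` on the ball. -/
theorem contDiffOn_ball {u : (Fin 2 → ℂ) → ℂ} (hu : DifferentiableOn ℂ u ball) (n : ℕ) :
    ContDiffOn ℂ n u ball :=
  contDiffOn_of_isOpen isOpen_ball n hu

/-- A holomorphic function on the ball is `C^n` over `ℝ` on the ball. -/
theorem contDiffOn_real_ball {u : (Fin 2 → ℂ) → ℂ} (hu : DifferentiableOn ℂ u ball) (n : ℕ) :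
    ContDiffOn ℝ n u ball :=
  contDiffOn_real_of_isOpen isOpen_ball hu n

/-- The partial derivatives of a holomorphic function on the ball are `C^n` over `ℝ` on the ball. -/
theorem contDiffOn_real_pd_ball {u : (Fin 2 → ℂ) → ℂ} (hu : DifferentiableOn ℂ u ball) (k : Fin 2) (n : ℕ) :
    ContDiffOn ℝ n (pd k u) ball :=
  contDiffOn_real_of_isOpen isOpen_ball (differentiableOn_pd_ball hu k) n

/-- Mixed second partials commute on the ball. -/
theorem pd_pd_comm {u : (Fin 2 → ℂ) → ℂ} (hu : DifferentiableOn ℂ u ball) (m k : Fin 2) {z : Fin 2 → ℂ}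
    (hz : z ∈ ball) : pd m (pd k u) z = pd k (pd m u) z :=
  pd_pd_comm_of_isOpen isOpen_ball hu m k hz

end Summit.Ventures.HodgeRepro.Tier4.Line4

end

#print axioms Summit.Ventures.HodgeRepro.Tier4.Line4.differentiableOn_pd_ball
#print axioms Summit.Ventures.HodgeRepro.Tier4.Line4.contDiffOn_real_pd_ball
#print axioms Summit.Ventures.HodgeRepro.Tier4.Line4.pd_pd_comm
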